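import Summits.NavierStokesRegularity.NavierStokesRegularity.Theorems.AdaptedFrequencyAdaptedKernelExistsLowerOfUpperBridge
import Literature.Analysis.FluidPDE.WholeSpaceIBP
import Literature.Analysis.PDE.RellichSphericalMoments
import Mathlib.Analysis.Calculus.ParametricIntegral

/-!
# Crux `AdaptedKernelExists` (stmt-NavierStokesRegularity-2956), line `nash-entropy-last-block`:
  STUB `stub_kernelLimit`, part 1 — pairings of an adapted kernel with test functions

Helper file (lands `--supports stmt-NavierStokesRegularity-2956`) on the proof path of the
registered stub `stub_kernelLimit` (passage to the limit along a family of uniformly comparable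
adapted kernels).  The limit is extracted from the PAIRINGS `t ↦ ∫ ψ(x) G(t, x) dx` of the
kernels with compactly supported test functions `ψ`; this file proves, for ONE adapted backward
kernel `G` of `∂ₜ + b·∇ − νΔ` on `Ico tₘ T` with a jointly smooth divergence-free drift `b`:

* (Green's second identity `∫ f Δφ = ∫ (Δf) φ` is the tree's
  `Literature.Analysis.PDE.Rellich.integral_mul_laplacian_eq`);
* `kernelLimit_integral_mul_fderiv_apply` — the transport identity
  `∫ ψ Df[v] = −∫ f Dψ[v]` for a divergence-free `C¹` field `v` (`ψ` compactly supported);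
* `kernelLimit_hasDerivAt_pairing` — at interior times `t ∈ Ioo tₘ T`,
  `d/dt ∫ ψ G(t) = ∫ G(t) (Dψ[b(t)] − ν Δψ)` (differentiation under the integral on the compact
  support of `ψ`, adjoint equation, the transport identity and Green's identity);
* `kernelLimit_abs_deriv_pairing_le` — the bound `|d/dt ∫ ψ G(t)| ≤ A‖Dψ‖∞ + ν‖Δψ‖∞` when
  `‖b(t)‖ ≤ A` on the support of `ψ` (unit mass and positivity of `G(t)`);
* `kernelLimit_pairing_lipschitz` — hence `|∫ψG(t) − ∫ψG(s)| ≤ L|t − s|` on every compact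
  `[t₁, t₂] ⊂ (tₘ, T)` with `L = A‖Dψ‖∞ + ν‖Δψ‖∞`, `A` a drift bound on `[t₁, t₂] × supp ψ` — the
  EQUICONTINUITY in time of the pairings, uniform along any family of kernels with a common local
  drift bound.
-/

noncomputable section

open MeasureTheory Set Filter Topology Metric Function
open scoped Laplacian ContDiff RealInnerProductSpace
open Literature.Analysis.FluidPDE

namespace Summit.NavierStokesRegularity.NavierStokesRegularity.Theorems.AdaptedKernelExists.NashEntropyLastBlock

section General

variable {E : Type*} [NormedAddCommGroup E] [InnerProductSpace ℝ E] [FiniteDimensional ℝ E]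
  [MeasurableSpace E] [BorelSpace E]

/-- **Transport identity for a divergence-free field**: `∫ ψ Df[v] = −∫ f Dψ[v]` for `f ∈ C¹`,
`ψ ∈ C¹_c` and a divergence-free `C¹` field `v` (the tree's `∫ θ div v + ∫ ⟪v, ∇θ⟫ = 0` with
`θ = ψ f`). -/
theorem kernelLimit_integral_mul_fderiv_apply {f ψ : E → ℝ} {v : E → E} (hf : ContDiff ℝ 1 f)
    (hψ : ContDiff ℝ 1 ψ) (hψc : HasCompactSupport ψ) (hv : ContDiff ℝ 1 v)
    (hdiv : VectorCalculus.IsDivFree v) :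
    ∫ x, ψ x * fderiv ℝ f x (v x) = -∫ x, f x * fderiv ℝ ψ x (v x) := by
  have hθ : ContDiff ℝ 1 fun x => ψ x * f x := hψ.mul hf
  have hθc : HasCompactSupport fun x => ψ x * f x := hψc.mul_right
  have h := integral_mul_divergence_add_eq_zero_left hθ hv hθc
  have h0 : ∫ x, ψ x * f x * VectorCalculus.divergence v x = 0 := by
    simp [hdiv _]
  rw [h0, zero_add] at h
  have hgrad : ∀ x, ⟪v x, gradient (fun y => ψ y * f y) x⟫ =
      ψ x * fderiv ℝ f x (v x) + f x * fderiv ℝ ψ x (v x) := by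
    intro x
    rw [gradient, real_inner_comm, InnerProductSpace.toDual_symm_apply,
      fderiv_fun_mul (hψ.differentiable one_ne_zero x) (hf.differentiable one_ne_zero x)]
    rfl
  simp_rw [hgrad] at h
  have hi1 : Integrable fun x => ψ x * fderiv ℝ f x (v x) :=
    (hψ.continuous.mul ((hf.continuous_fderiv one_ne_zero).clm_apply hv.continuous))
      |>.integrable_of_hasCompactSupport hψc.mul_right
  have hi2 : Integrable fun x => f x * fderiv ℝ ψ x (v x) := by
    refine (hf.continuous.mul ((hψ.continuous_fderiv one_ne_zero).clm_apply hv.continuous))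
      |>.integrable_of_hasCompactSupport ?_
    refine (hψc.fderiv (𝕜 := ℝ)).mono fun x hx => ?_
    rw [mem_support] at hx ⊢
    contrapose! hx
    simp [hx]
  rw [integral_add hi1 hi2] at h
  linarith


/-! ### The derivative of a pairing -/

/-- **Derivative of the pairing of an adapted kernel with a test function.**  For an adapted
backward kernel `G` of `∂ₜ + b·∇ − νΔ` on `Ico tₘ T` with a jointly smooth divergence-free drift
and a compactly supported `ψ ∈ C²`, at every interior time `t ∈ Ioo tₘ T`,
`d/dt ∫ ψ G(t) = ∫ G(t) (Dψ[b(t)] − ν Δψ)` (differentiation under the integral on the compact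
support of `ψ`, then the adjoint equation `∂ₜG = −DG[b] − νΔG` and integration by parts:
`∫ ψ DG[b] = −∫ G Dψ[b]` since `div b = 0`, `∫ ψ ΔG = ∫ G Δψ`). -/
theorem kernelLimit_hasDerivAt_pairing {ν tₘ T : ℝ} {b : ℝ → E → E} {x₀ : E} {G : ℝ → E → ℝ}
    (hb : IsSmoothSpaceTimeOn (Ico tₘ T) b) (hdiv : ∀ t ∈ Ico tₘ T, VectorCalculus.IsDivFree (b t))
    (hG : IsAdaptedBackwardKernel ν b (Ico tₘ T) T x₀ G) {ψ : E → ℝ} (hψ : ContDiff ℝ 2 ψ)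
    (hψc : HasCompactSupport ψ) {t : ℝ} (ht : t ∈ Ioo tₘ T) :
    HasDerivAt (fun s => ∫ x, ψ x * G s x)
      (∫ x, G t x * (fderiv ℝ ψ x (b t x) - ν * (Δ ψ) x)) t := by
  have hIco : Ioo tₘ T ⊆ Ico tₘ T := Ioo_subset_Ico_self
  have hO : IsOpen (Ioo tₘ T ×ˢ (univ : Set E)) := isOpen_Ioo.prod isOpen_univ
  have hG2 : ContDiffOn ℝ 2 (uncurry G) (Ioo tₘ T ×ˢ univ) :=
    hG.contDiffOn.mono (prod_mono hIco Subset.rfl)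
  have hDc : ContinuousOn (fun p : ℝ × E => fderiv ℝ (uncurry G) p) (Ioo tₘ T ×ˢ univ) :=
    hG2.continuousOn_fderiv_of_isOpen hO (by norm_num)
  have hD : ∀ s ∈ Ioo tₘ T, ∀ x, HasFDerivAt (uncurry G) (fderiv ℝ (uncurry G) (s, x)) (s, x) :=
    fun s hs x => ((hG2.differentiableOn (by norm_num)).differentiableAt
      (hO.mem_nhds ⟨hs, mem_univ x⟩)).hasFDerivAt
  -- a compact time interval around `t` inside the slab
  obtain ⟨ε, hε, hεI⟩ : ∃ ε : ℝ, 0 < ε ∧ Icc (t - ε) (t + ε) ⊆ Ioo tₘ T := by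
    have hm : 0 < min (t - tₘ) (T - t) := lt_min (sub_pos.2 ht.1) (sub_pos.2 ht.2)
    refine ⟨min (t - tₘ) (T - t) / 2, by positivity, fun s hs => ⟨?_, ?_⟩⟩
    · have h1 : min (t - tₘ) (T - t) ≤ t - tₘ := min_le_left _ _
      linarith [hs.1]
    · have h1 : min (t - tₘ) (T - t) ≤ T - t := min_le_right _ _
      linarith [hs.2]
  have hball : ball t ε ⊆ Icc (t - ε) (t + ε) := fun s hs => by
    rw [mem_ball, Real.dist_eq, abs_lt] at hs
    exact ⟨by linarith, by linarith⟩
  -- a bound for the time derivative on `[t − ε, t + ε] × tsupport ψ`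
  have hDc1 : ContinuousOn (fun p : ℝ × E => fderiv ℝ (uncurry G) p (1, 0)) (Ioo tₘ T ×ˢ univ) :=
    hDc.clm_apply continuousOn_const
  obtain ⟨M, hM0, hM⟩ : ∃ M : ℝ, 0 ≤ M ∧ ∀ p ∈ Icc (t - ε) (t + ε) ×ˢ tsupport ψ,
      ‖fderiv ℝ (uncurry G) p (1, 0)‖ ≤ M := by
    have hK : IsCompact (Icc (t - ε) (t + ε) ×ˢ tsupport ψ) := isCompact_Icc.prod hψc
    obtain ⟨M, hM⟩ := hK.exists_bound_of_continuousOn (hDc1.mono (prod_mono hεI (subset_univ _)))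
    exact ⟨max M 0, le_max_right _ _, fun p hp => (hM p hp).trans (le_max_left _ _)⟩
  -- the derivative under the integral sign
  have hψ0 : ∀ x ∉ tsupport ψ, ψ x = 0 := fun x hx => image_eq_zero_of_notMem_tsupport hx
  have key := hasDerivAt_integral_of_dominated_loc_of_deriv_le (μ := (volume : Measure E))
    (F := fun s x => ψ x * G s x) (F' := fun s x => ψ x * fderiv ℝ (uncurry G) (s, x) (1, 0))
    (x₀ := t) (bound := fun x => |ψ x| * M) (ball_mem_nhds t hε) ?_ ?_ ?_ ?_ ?_ ?_
  · -- identify the derivative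
    have hform : ∫ x, ψ x * fderiv ℝ (uncurry G) (t, x) (1, 0) =
        ∫ x, G t x * (fderiv ℝ ψ x (b t x) - ν * (Δ ψ) x) := by
      have htI : t ∈ Ico tₘ T := hIco ht
      -- the adjoint equation at the interior time `t`
      have hadj : ∀ x, fderiv ℝ (uncurry G) (t, x) (1, 0) =
          -(fderiv ℝ (G t) x (b t x)) - ν * (Δ (G t)) x := by
        intro x
        have heq := hG.adjoint_eq t htI x
        rw [timeDerivWithin_eq_deriv_of_mem_nhds (Ico_mem_nhds ht.1 ht.2),
          (hasDerivAt_timeLine (hD t ht x)).deriv] at heq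
        linarith
      simp_rw [hadj]
      have hGt : ContDiff ℝ 2 (G t) := hG.contDiff_slice htI
      have hbt : ContDiff ℝ 1 (b t) := (hb.contDiff_slice htI).of_le (by norm_cast)
      have e1 : ∫ x, ψ x * fderiv ℝ (G t) x (b t x) = -∫ x, G t x * fderiv ℝ ψ x (b t x) :=
        kernelLimit_integral_mul_fderiv_apply (hGt.of_le one_le_two) (hψ.of_le one_le_two) hψc
          hbt (hdiv t htI)
      have e2 : ∫ x, ψ x * (Δ (G t)) x = ∫ x, G t x * (Δ ψ) x := by
        rw [Literature.Analysis.PDE.Rellich.integral_mul_laplacian_eq hGt hψ hψc]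
        exact integral_congr_ae (Eventually.of_forall fun x => mul_comm _ _)
      -- integrability of the pieces (continuous with compact support)
      have hcψ : Continuous ψ := hψ.continuous
      have hcG : Continuous (G t) := hGt.continuous
      have hcDG : Continuous fun x => fderiv ℝ (G t) x (b t x) :=
        (hGt.continuous_fderiv (by norm_num)).clm_apply hbt.continuous
      have hcΔG : Continuous (Δ (G t)) := continuous_laplacian hGt
      have hcDψ : Continuous fun x => fderiv ℝ ψ x (b t x) :=
        (hψ.continuous_fderiv (by norm_num)).clm_apply hbt.continuous
      have hcΔψ : Continuous (Δ ψ) := continuous_laplacian hψ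
      have hi1 : Integrable fun x => ψ x * fderiv ℝ (G t) x (b t x) :=
        (hcψ.mul hcDG).integrable_of_hasCompactSupport hψc.mul_right
      have hi2 : Integrable fun x => ψ x * (ν * (Δ (G t)) x) :=
        (hcψ.mul (continuous_const.mul hcΔG)).integrable_of_hasCompactSupport hψc.mul_right
      have hsuppD : HasCompactSupport fun x => G t x * fderiv ℝ ψ x (b t x) := by
        refine (hψc.fderiv (𝕜 := ℝ)).mono fun x hx => ?_
        rw [mem_support] at hx ⊢
        contrapose! hx
        simp [hx]
      have hsuppΔ : HasCompactSupport fun x => G t x * (ν * (Δ ψ) x) := by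
        refine hψc.mono' ?_
        intro x hx
        rw [mem_support] at hx
        contrapose! hx
        simp [laplacian_eq_zero_of_notMem_tsupport hx]
      have hi3 : Integrable fun x => G t x * fderiv ℝ ψ x (b t x) :=
        (hcG.mul hcDψ).integrable_of_hasCompactSupport hsuppD
      have hi4 : Integrable fun x => G t x * (ν * (Δ ψ) x) :=
        (hcG.mul (continuous_const.mul hcΔψ)).integrable_of_hasCompactSupport hsuppΔ
      have e3 : ∫ x, ψ x * (ν * (Δ (G t)) x) = ∫ x, G t x * (ν * (Δ ψ) x) := by
        calc ∫ x, ψ x * (ν * (Δ (G t)) x) = ν * ∫ x, ψ x * (Δ (G t)) x := by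
              rw [← integral_const_mul]
              exact integral_congr_ae (Eventually.of_forall fun x => by ring)
          _ = ν * ∫ x, G t x * (Δ ψ) x := by rw [e2]
          _ = ∫ x, G t x * (ν * (Δ ψ) x) := by
              rw [← integral_const_mul]
              exact integral_congr_ae (Eventually.of_forall fun x => by ring)
      calc ∫ x, ψ x * (-(fderiv ℝ (G t) x (b t x)) - ν * (Δ (G t)) x)
          = ∫ x, (-(ψ x * fderiv ℝ (G t) x (b t x)) - ψ x * (ν * (Δ (G t)) x)) :=
            integral_congr_ae (Eventually.of_forall fun x => by ring)
        _ = -(∫ x, ψ x * fderiv ℝ (G t) x (b t x)) - ∫ x, ψ x * (ν * (Δ (G t)) x) := by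
            rw [integral_sub (f := fun x => -(ψ x * fderiv ℝ (G t) x (b t x))) hi1.neg hi2,
              integral_neg]
        _ = (∫ x, G t x * fderiv ℝ ψ x (b t x)) - ∫ x, G t x * (ν * (Δ ψ) x) := by
            rw [e1, neg_neg, e3]
        _ = ∫ x, G t x * (fderiv ℝ ψ x (b t x) - ν * (Δ ψ) x) := by
            rw [← integral_sub hi3 hi4]
            exact integral_congr_ae (Eventually.of_forall fun x => by ring)
    rw [← hform]
    exact key.2
  · -- measurability of `F s` near `t`
    filter_upwards [ball_mem_nhds t hε] with s hs
    have hsI : s ∈ Ico tₘ T := hIco (hεI (hball hs))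
    exact (hψ.continuous.mul (hG.contDiff_slice hsI).continuous).aestronglyMeasurable
  · -- integrability of `F t`
    exact (hψ.continuous.mul (hG.contDiff_slice (hIco ht)).continuous).integrable_of_hasCompactSupport
      hψc.mul_right
  · -- measurability of `F' t`
    have hc : Continuous fun x => fderiv ℝ (uncurry G) (t, x) (1, 0) := by
      have h1 : ContinuousOn (fun x : E => fderiv ℝ (uncurry G) (t, x) (1, 0)) univ :=
        hDc1.comp (continuous_const.prodMk continuous_id).continuousOn
          (fun x _ => ⟨ht, mem_univ x⟩)
      exact continuousOn_univ.1 h1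
    exact (hψ.continuous.mul hc).aestronglyMeasurable
  · -- the domination `‖F' s x‖ ≤ |ψ x| M` on the ball
    refine Eventually.of_forall fun x s hs => ?_
    by_cases hx : x ∈ tsupport ψ
    · have hp : (s, x) ∈ Icc (t - ε) (t + ε) ×ˢ tsupport ψ := ⟨hball hs, hx⟩
      rw [norm_mul, Real.norm_eq_abs]
      exact mul_le_mul_of_nonneg_left (hM _ hp) (abs_nonneg _)
    · rw [hψ0 x hx]
      simp
  · -- integrability of the bound
    exact (continuous_abs.comp hψ.continuous).integrable_of_hasCompactSupport
      (hψc.norm.mono (by intro x; simp [Real.norm_eq_abs])) |>.mul_const M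
  · -- pointwise derivative of `s ↦ ψ x G(s, x)` on the ball
    refine Eventually.of_forall fun x s hs => ?_
    have hsO : s ∈ Ioo tₘ T := hεI (hball hs)
    exact (hasDerivAt_timeLine (hD s hsO x)).const_mul (ψ x)

/-- **Bound for the derivative of a pairing.**  In the situation of
`kernelLimit_hasDerivAt_pairing`, if `‖b(t, x)‖ ≤ A` on the support of `ψ`, `‖Dψ‖ ≤ M₁` and
`|Δψ| ≤ M₂` everywhere, then `|∫ G(t) (Dψ[b(t)] − νΔψ)| ≤ A M₁ + ν M₂` (`G(t) ≥ 0` has unit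
mass, `ν ≥ 0`). -/
theorem kernelLimit_abs_deriv_pairing_le {ν t A M₁ M₂ : ℝ} {S : Set ℝ} {T : ℝ} {b : ℝ → E → E}
    {x₀ : E} {G : ℝ → E → ℝ} (hν : 0 ≤ ν) (hG : IsAdaptedBackwardKernel ν b S T x₀ G) (ht : t ∈ S)
    {ψ : E → ℝ} (hA : 0 ≤ A) (hbA : ∀ x ∈ tsupport ψ, ‖b t x‖ ≤ A)
    (hM₁ : ∀ x, ‖fderiv ℝ ψ x‖ ≤ M₁) (hM₂ : ∀ x, |(Δ ψ) x| ≤ M₂) :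
    |∫ x, G t x * (fderiv ℝ ψ x (b t x) - ν * (Δ ψ) x)| ≤ A * M₁ + ν * M₂ := by
  have hG0 : ∀ x, 0 ≤ G t x := fun x => (hG.pos t ht x).le
  have hpt : ∀ x, |G t x * (fderiv ℝ ψ x (b t x) - ν * (Δ ψ) x)| ≤ G t x * (A * M₁ + ν * M₂) := by
    intro x
    rw [abs_mul, abs_of_nonneg (hG0 x)]
    refine mul_le_mul_of_nonneg_left ?_ (hG0 x)
    have h1 : |fderiv ℝ ψ x (b t x)| ≤ A * M₁ := by
      by_cases hx : x ∈ tsupport ψ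
      · calc |fderiv ℝ ψ x (b t x)| = ‖fderiv ℝ ψ x (b t x)‖ := (Real.norm_eq_abs _).symm
          _ ≤ ‖fderiv ℝ ψ x‖ * ‖b t x‖ := ContinuousLinearMap.le_opNorm _ _
          _ ≤ M₁ * A := mul_le_mul (hM₁ x) (hbA x hx) (norm_nonneg _)
              ((norm_nonneg _).trans (hM₁ x))
          _ = A * M₁ := mul_comm _ _
      · rw [fderiv_of_notMem_tsupport ℝ hx]
        change |(0 : ℝ)| ≤ A * M₁
        rw [abs_zero]
        exact mul_nonneg hA ((norm_nonneg _).trans (hM₁ x))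
    have h2 : |ν * (Δ ψ) x| ≤ ν * M₂ := by
      rw [abs_mul, abs_of_nonneg hν]
      exact mul_le_mul_of_nonneg_left (hM₂ x) hν
    calc |fderiv ℝ ψ x (b t x) - ν * (Δ ψ) x|
        ≤ |fderiv ℝ ψ x (b t x)| + |ν * (Δ ψ) x| := abs_sub _ _
      _ ≤ A * M₁ + ν * M₂ := add_le_add h1 h2
  calc |∫ x, G t x * (fderiv ℝ ψ x (b t x) - ν * (Δ ψ) x)|
      ≤ ∫ x, |G t x * (fderiv ℝ ψ x (b t x) - ν * (Δ ψ) x)| := abs_integral_le_integral_abs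
    _ ≤ ∫ x, G t x * (A * M₁ + ν * M₂) := by
        refine integral_mono_of_nonneg (Eventually.of_forall fun x => abs_nonneg _)
          ((hG.integrable ht).mul_const _) (Eventually.of_forall hpt)
    _ = A * M₁ + ν * M₂ := by rw [integral_mul_const, hG.integral_eq_one t ht, one_mul]


/-- **Equicontinuity in time of the pairings.**  For an adapted backward kernel `G` of
`∂ₜ + b·∇ − νΔ` on `Ico tₘ T` (jointly smooth divergence-free drift), a compactly supported
`ψ ∈ C²` with `‖Dψ‖ ≤ M₁`, `|Δψ| ≤ M₂`, and a compact interval `[t₁, t₂] ⊂ (tₘ, T)` on which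
`‖b‖ ≤ A` over the support of `ψ`: `|∫ψG(t) − ∫ψG(s)| ≤ (A M₁ + ν M₂)|t − s|` for
`s, t ∈ [t₁, t₂]`.  The constant depends on the kernel ONLY through `A` (mean value inequality
with `kernelLimit_hasDerivAt_pairing` and `kernelLimit_abs_deriv_pairing_le`). -/
theorem kernelLimit_pairing_lipschitz {ν tₘ T t₁ t₂ A M₁ M₂ : ℝ} {b : ℝ → E → E} {x₀ : E}
    {G : ℝ → E → ℝ} (hν : 0 ≤ ν) (hb : IsSmoothSpaceTimeOn (Ico tₘ T) b)
    (hdiv : ∀ t ∈ Ico tₘ T, VectorCalculus.IsDivFree (b t))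
    (hG : IsAdaptedBackwardKernel ν b (Ico tₘ T) T x₀ G) {ψ : E → ℝ} (hψ : ContDiff ℝ 2 ψ)
    (hψc : HasCompactSupport ψ) (h₁ : tₘ < t₁) (h₂ : t₂ < T) (hA : 0 ≤ A)
    (hbA : ∀ s ∈ Icc t₁ t₂, ∀ x ∈ tsupport ψ, ‖b s x‖ ≤ A) (hM₁ : ∀ x, ‖fderiv ℝ ψ x‖ ≤ M₁)
    (hM₂ : ∀ x, |(Δ ψ) x| ≤ M₂) {s t : ℝ} (hs : s ∈ Icc t₁ t₂) (ht : t ∈ Icc t₁ t₂) :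
    |(∫ x, ψ x * G t x) - ∫ x, ψ x * G s x| ≤ (A * M₁ + ν * M₂) * |t - s| := by
  have hsub : Icc t₁ t₂ ⊆ Ioo tₘ T := fun r hr => ⟨h₁.trans_le hr.1, hr.2.trans_lt h₂⟩
  have key := Convex.norm_image_sub_le_of_norm_hasDerivWithin_le (C := A * M₁ + ν * M₂)
    (f := fun r => ∫ x, ψ x * G r x)
    (f' := fun r => ∫ x, G r x * (fderiv ℝ ψ x (b r x) - ν * (Δ ψ) x))
    (fun r hr => (kernelLimit_hasDerivAt_pairing hb hdiv hG hψ hψc (hsub hr)).hasDerivWithinAt)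
    (fun r hr => ?_) (convex_Icc t₁ t₂) hs ht
  · simpa only [Real.norm_eq_abs] using key
  · rw [Real.norm_eq_abs]
    exact kernelLimit_abs_deriv_pairing_le hν hG (Ioo_subset_Ico_self (hsub hr)) hA
      (hbA r hr) hM₁ hM₂

end General

/-! ### Registered sub-goal (dimension three) -/

/-- **Registered sub-goal `stub_kernelLimit_pairingLipschitz`** (the `ℝ³` form of
`kernelLimit_pairing_lipschitz`; part 1 of the proof of STUB `stub_kernelLimit`): the pairings
`t ↦ ∫ ψ G(t)` of an adapted backward kernel with a compactly supported `C²` test function are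
Lipschitz on compact sub-intervals of `(tₘ, T)`, with a constant depending on the kernel only
through a local drift bound. -/
theorem stub_kernelLimit_pairingLipschitz :
    ∀ (ν tₘ T t₁ t₂ A M₁ M₂ : ℝ) (b : ℝ → EuclideanSpace ℝ (Fin 3) → EuclideanSpace ℝ (Fin 3)) (x₀ : EuclideanSpace ℝ (Fin 3)) (G : ℝ → EuclideanSpace ℝ (Fin 3) → ℝ) (ψ : EuclideanSpace ℝ (Fin 3) → ℝ) (s t : ℝ), 0 ≤ ν → IsSmoothSpaceTimeOn (Ico tₘ T) b → (∀ t ∈ Ico tₘ T, VectorCalculus.IsDivFree (b t)) → IsAdaptedBackwardKernel ν b (Ico tₘ T) T x₀ G → ContDiff ℝ 2 ψ → HasCompactSupport ψ → tₘ < t₁ → t₂ < T → 0 ≤ A → (∀ s ∈ Icc t₁ t₂, ∀ x ∈ tsupport ψ, ‖b s x‖ ≤ A) → (∀ x, ‖fderiv ℝ ψ x‖ ≤ M₁) → (∀ x, |(Δ ψ) x| ≤ M₂) → s ∈ Icc t₁ t₂ → t ∈ Icc t₁ t₂ → |(∫ x, ψ x * G t x) - ∫ x, ψ x * G s x| ≤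 (A * M₁ + ν * M₂) * |t - s| :=
  fun _ _ _ _ _ _ _ _ _ _ _ _ _ _ hν hb hdiv hG hψ hψc h₁ h₂ hA hbA hM₁ hM₂ hs ht =>
    kernelLimit_pairing_lipschitz hν hb hdiv hG hψ hψc h₁ h₂ hA hbA hM₁ hM₂ hs ht

end Summit.NavierStokesRegularity.NavierStokesRegularity.Theorems.AdaptedKernelExists.NashEntropyLastBlock

end
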